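import Summits.SmoothPoincare4.SmoothPoincare4.Theses.ConvexBisection
import Literature.Topology.FourManifolds.Gluing
import Literature.Topology.FourManifolds.BalancedPresentation
import Summits.SmoothPoincare4.SmoothPoincare4.Theorems.ContractibleTwistedDoubleStandard.Negative.DoubleBisection
import Summits.SmoothPoincare4.SmoothPoincare4.Theorems.ConvexBisectionPlanarBisectionRigidityStubPlanarSeamTransfer
import HarnessLib

/-!
# Line `seam-walk-one-sided-ball` for crux `ConvexBisection.PlanarBisectionRigidity`
(item stmt-SmoothPoincare4-10511, route `route-SmoothPoincare4-ConvexBisection`, rank 5)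

Skeleton (crux-plan, planner-cruxplan-stmt-SmoothPoincare4-10511-seam-walk-one-sided--0, 2026-08-16)
of the card `Cruxes/PlanarBisectionRigidity/Ideas/seam-walk-one-sided-ball.md` ("walk the seam to a
ball"), reshaped by the three triage notes (TRIAGE-r1-1/2/3, all `pass`):
* the walk's recogniser is `π₁(Γ′) = 1` read off ARC DATA (r1-1 (a)–(c): type-collapsibility is
  unsound, the Artin action alone is not faithful) — so the whole word calculus is typed here over the
  faithful arc-data model of the framed braid group (§1, definitions only, no axioms, no `sorry`);
* the line is `PBR(integral) ⟸ REACH(integral) ∧ (absorbing target)` and the TORSION sector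
  (`H₁(W₁;ℤ) ≠ 0`, inhabited: r1-2 (S1), 19 explicit `Σ(A,B)` with seam `S³/Q₈`, and the round `S⁴`
  itself) is filed as a separate residual stub with another lever (r1-2, r1-3);
* the walk gets a SECOND absorbing target, the honest double `A′ = B′` (then `Σ ≅ D(X_{A′})` with
  `X_{A′}` contractible), so that the Andrews–Curtis-strength content every line on this crux shares
  (r1-3 (F1): `PlanarSteinDoubleStandard`) is isolated in ONE residual stub instead of hiding inside
  the lever.

THE CRUX. For every Hausdorff second-countable `C^∞` 4-manifold `M ≃ₕ S⁴`: if `M = e₁(W₁) ∪ e₂(W₂)`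
for two smoothly embedded compact Stein domains meeting exactly along the images of their boundaries,
with the complex tangencies pushed forward to the same plane field on the seam, and the contact
boundary of `(W₁, J₁)` is PLANAR, then `M ≅ S⁴`.

THE LINE (six stubs; composition `PlanarBisectionRigidity_of`, kernel-checked, no `sorry` of its own).
* `stub_wendlDictionary` — DICTIONARY (known modulo vendoring; Wendl arXiv:0806.3193 Thm 1, Etnyre
  arXiv:math/0404267 Thm 4.1 + Mayer–Vietoris, achiral Lefschetz handle calculus GS §8.2/8.4, Baykur
  arXiv:math/0601396, Laudenbach–Poénaru).  In the integral sector the bisection is READ as a planar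
  word: `W₁ ≅ X_A`, `W₂ ≅ X_B` for two positive factorisations `A`, `B` of one monodromy of length
  `n = k − 1` over the disc with `n` holes, `⟨x | A, B⟩ = 1`, both hole-set matrices unimodular
  (`IsIntegralSphereWord`); and every state REACHABLE from the achiral word `A · B̄ʳᵉᵛ` by signed
  Hurwitz moves, rotations, global conjugations and planar (de)stabilisations is WRITTEN back as a
  planar common-contact Stein bisection of the same `M` — so a reachable block word whose positive
  block has trivial seam group re-bisects `M` with a simply connected seam, and a reachable honest
  double `A′ = B′` exhibits `M` as the double of a contractible planar Stein domain.
* `stub_seamWalk` — THE LEVER = REACH(integral), pure combinatorics of the framed braid group: every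
  integral homotopy-sphere word walks to a block word with trivial positive seam group OR to an honest
  double.  New; machine-attackable (BFS on Disproof §7's certified twisted pairs); STRONGER than SPC4 in
  its sector (a Hurwitz-rigid orbit inside `S⁴` refutes it without an exotic sphere) — the line's bet.
* `stub_simplyConnectedSeam` — ABSORBING TARGET 1 (known: Perelman ⇒ seam `S³`; then the route's
  support item `SphereSeamStandard` = Eliashberg 1992 + `Eliashberg1990_steinFilling_sphere_three` +
  `cerf_twistedSphere_four`): a common-contact Stein bisection with simply connected seam is `S⁴`.
* `stub_planarSteinDouble` — ABSORBING TARGET 2 = the shared residual `PlanarSteinDoubleStandard`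
  (FirstLemmasIdeator3; `D(W) ≅ S⁴` for contractible planar Stein `W`; ⟸ item stmt-SmoothPoincare4-3717
  `PresentationSpheresStandard` on paper, `D(W) = ∂(W × I)`; Andrews–Curtis strength by TRIAGE-r1-3 (F1)).
* `stub_etnyreFact` + `stub_etnyrePlanarAcyclicOfFact` (lead reshape of the planner's `stub_etnyrePlanarAcyclic`:
  the cite fact Etnyre arXiv:math/0404267 Thm 4.1 isolated as its own stub, and the Mayer–Vietoris
  derivation from it, provable now): the halves of a planar common-contact bisection of a homotopy 4-sphere are ℚ-acyclic; feeds
* `stub_torsionSector` — RESIDUAL outside the lever's reach (`H₁(W₁;ℤ) ≠ 0` is a walk invariant):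
  quaternionic/prism seams, ℚHB halves; first inhabitant `S⁴ = X_L ∪_ψ X̄_L` standard by Price 1977 /
  Kim–Miller; lever = filling classification + Price, not the walk (TRIAGE-r1-2 (S1), r1-3 (F2)).
  PROVED from crux `AcyclicBisectionRigidity` (stmt-10507, rank 2, staffed): `torsionSector_of_acyclicRigidity`.
* `PlanarBisectionRigidity_of : ConvexBisection.PlanarBisectionRigidity` — case on
  `IsZero (H₁(W₁;ℤ))`; integral: dictionary ⇒ word, lever ⇒ target, dictionary ⇒ re-bisection,
  absorbing Stub 3 or 4; torsion: Stub 5 ⇒ Stub 6.  Pure logic.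
Delegation edges proved in §4: Stub 3 ⟸ support item `SphereSeamStandard` (10510) + Poincaré–Perelman;
Stub 6 ⟸ crux `AcyclicBisectionRigidity` (10507); on paper Stub 4 ⟸ crux `PresentationSpheresStandard`
(3717).  The line's OWN work is Stubs 1–2 (+ the known Stub 5).

DISPROOF USED.  `payload.disproof_path` (run/gate/evidence/stmt-SmoothPoincare4-10511/20260816T000009Z-
Disproof.lean, cdisprove v5) is not mounted in this jail and `ledger crux cat … Disproof.lean` reports no
workfile (same for all three triagers); its CONTENT is cited from the item's evidence notes v1–v5:
`of_smoothPoincare4` (crux ⇐ SPC4: stubs 3–5 and the dictionary have the shielded shape, the lever does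
NOT — it is refutable by computation, which is the point); `WithoutPlanar ∧ SteinBisectionExists ⇒ SPC4`
(planarity is load-bearing: used at `stub_wendlDictionary`, Wendl's theorem needs a planar seam, and at
`stub_seamWalk`, whose state space exists only for genus-0 pages); `WithoutHomotopyEquiv` false
(`S¹×S³ = D(S¹×D³)`): `M ≃ₕ S⁴` is used at the dictionary (`⟨x | A, B⟩ = 1`) and at stub 5;
`HalvesAreBalls` false (Akbulut-cork double): no stub asserts a half is a ball — the walk MANUFACTURES a
ball half elsewhere in the orbit or ends in a double; §7 census (k = 5: 8 certified Hurwitz-inequivalent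
contractible pairs; k = 4: 64 pairs, all certified inequivalent; all doubles AC-trivial): these are the
first instances of `stub_seamWalk` (BFS benchmark) and lie in the integral sector; TRIAGE-r1-2 (S1)'s 19
torsion pairs are a NEGATIVE control (the walk can reach neither target there: `H₁ = ℤ/2` is invariant and
`π₁ D(X_{A′}) ≠ 1`) and belong to stub 5.  No `Theorems/PlanarBisectionRigidity/Negative/` lemma has landed;
`ledger negatives --problem SmoothPoincare4` = 0 (2026-08-16).
-/

noncomputable section

open scoped Manifold ContDiff Topology ContinuousMap
open Set Function
open Literature.Geometry.Symplectic Literature.AlgebraicTopology.SingularHomology CategoryTheory.Limits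
open Literature.Topology.FourManifolds (BoundaryData IsDouble)

-- The namespace is prescribed by the crux protocol (`Summit.<P>.<Sub>.Cruxes.<Crux>.<Slug>` with
-- `P = Sub = SmoothPoincare4`), hence the duplicated component.
set_option linter.dupNamespace false
set_option linter.unusedVariables false

namespace Summit.SmoothPoincare4.SmoothPoincare4.Cruxes.PlanarBisectionRigidity.SeamWalkOneSidedBall

open Summit.SmoothPoincare4.SmoothPoincare4.Theses

/-- Local notation: the round 4-sphere with its Mathlib manifold structure. -/
local notation "𝕊⁴" => (Metric.sphere (0 : EuclideanSpace ℝ (Fin 5)) 1)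

/-- Local notation: the model space `ℝ⁴`. -/
local notation "E4" => EuclideanSpace ℝ (Fin 4)

/-! ## §1  The planar word calculus (definitions only; validated against the census conventions)

The page is the disc `D_n` with `n = k − 1` holes `0, …, n−1` (left to right), outer boundary `∂₀`,
base point `p₀ ∈ ∂₀`, disjoint arcs `δᵢ` from `p₀` to the hole `i`, free generators
`xᵢ = δᵢ ∂ᵢ δᵢ⁻¹` of `π₁(D_n, p₀) = F_n`.  A mapping class `φ` fixing `∂₀` pointwise and permuting the
holes without rotating them is recorded FAITHFULLY by its ARC DATA `(π, u)`, `φ(δᵢ) ≃ uᵢ · δ_{π i}`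
(Alexander method; TRIAGE-r1-1 (c), r1-2 (S1)): it induces `xᵢ ↦ uᵢ x_{π i} uᵢ⁻¹` on `F_n`, composes by
`u^{φψ}ᵢ = φ_*(u^ψᵢ) · u^φ_{π_ψ i}`, and
* the seam group is `π₁(OB(D_n, φ)) = ⟨x₀ … x_{n−1} ∣ u₀(φ), …, u_{n−1}(φ)⟩` — a BALANCED presentation
  (mapping torus + the `k` binding meridians; `OB(annulus, Tᵐ) = L(m, 1)` ✓);
* `π₁(X_A) = F_n / ⟨⟨[a₁], …, [aₙ]⟩⟩` and `π₁(X_A ∪ X̄_B) = F_n / ⟨⟨[aⱼ], [bⱼ]⟩⟩` (van Kampen through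
  the page group), `H₁(X_A) = ℤⁿ / ⟨[aⱼ]⟩`.
Generators: the non-rotating half-twists `σⱼ` (Artin: `xⱼ ↦ xⱼ xⱼ₊₁ xⱼ⁻¹`, `xⱼ₊₁ ↦ xⱼ`; arc data
`uⱼ = xⱼ`) and the Dehn twists `T_[a,b]` about the ROUND curve enclosing the consecutive holes `a … b`
(arc data `uᵢ = x_a ⋯ x_b` for `a ≤ i ≤ b`); every simple closed curve is `g(c_[a,b])` for a word `g`
in these, and its twist is `g T_[a,b] g⁻¹`.  A Python twin of these definitions (planner folder
`py/arcdata.py`) checks: `σⱼσⱼ⁻¹ = 1`, the braid relations, `T_[a,b]` commutes with the `σⱼ` inside and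
away from the block, nested/disjoint round twists commute, the full twist `(σ₀⋯σ_{n−2})ⁿ = T_[0,n−1] ∏ T_[i,i]⁻¹`
(`n ≤ 5`), the LANTERN relation `T_[0,2] T_0 T_1 T_2 = T_[0,1] T_{σ₁ c_[0,1]} T_[1,2]` on `D₃`, the seam
groups of the nested words (trivial = `S³`) and of `(annulus, Tᵐ)` (`ℤ/m`), and reproduces TRIAGE-r1-2's
torsion hit #1 verbatim (equal monodromies, `⟨x|A,B⟩ = 1`, `⟨x|A⟩ = ⟨x|B⟩ = ℤ/2`).  The chirality and
product-order conventions are immaterial for the TRUTH of the stubs below (reflection of the disc and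
reversal of words transport one convention to the other; the Hurwitz move set is forced by
monodromy-preservation), see the line card. -/

/-- ARC DATA of a (hole-permuting, non-rotating, `∂₀`-fixing) mapping class of the disc with `n` holes:
the permutation `π` of the holes and the words `uᵢ = [φ(δᵢ) · δ_{π i}⁻¹] ∈ F_n`. [folklore] -/
structure ArcData (n : ℕ) where
  /-- the permutation of the holes -/
  perm : Equiv.Perm (Fin n)
  /-- the arc words `uᵢ` -/
  u : Fin n → FreeGroup (Fin n)

namespace ArcData

variable {n : ℕ}

/-- The induced automorphism of `F_n = π₁(D_n, p₀)`: `xᵢ ↦ uᵢ · x_{π i} · uᵢ⁻¹`. [folklore] -/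
def aut (φ : ArcData n) : FreeGroup (Fin n) →* FreeGroup (Fin n) :=
  FreeGroup.lift fun i => φ.u i * FreeGroup.of (φ.perm i) * (φ.u i)⁻¹

/-- The identity mapping class. [folklore] -/
def one : ArcData n := ⟨1, fun _ => 1⟩

/-- Composition `φ ∘ ψ` (`ψ` first): `π = π_φ π_ψ`, `uᵢ = φ_*(u^ψᵢ) · u^φ_{π_ψ i}`. [folklore] -/
def mul (φ ψ : ArcData n) : ArcData n :=
  ⟨φ.perm * ψ.perm, fun i => φ.aut (ψ.u i) * φ.u (ψ.perm i)⟩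

end ArcData

/-- GENERATORS of the framed braid group of the holed disc, as hole-index syntax independent of `n`:
`sigma j inv` = the half-twist `σⱼ^{±1}` exchanging holes `j`, `j+1`; `round a b inv` = the Dehn twist
`T_[a,b]^{±1}` about the round curve enclosing the consecutive holes `a, …, b`. [folklore] -/
inductive PGen where
  | sigma (j : ℕ) (inv : Bool)
  | round (a b : ℕ) (inv : Bool)
  deriving DecidableEq

namespace PGen

/-- Formal inverse of a generator. [folklore] -/
def inv : PGen → PGen
  | sigma j s => sigma j (!s)
  | round a b s => round a b (!s)

/-- `g.below n`: the generator does not involve the hole `n` (nor any hole beyond it) — the support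
condition for stabilising curves. [folklore] -/
def below (n : ℕ) : PGen → Bool
  | sigma j _ => decide (j + 1 < n)
  | round _ b _ => decide (b < n)

/-- The word `x_a x_{a+1} ⋯ x_b ∈ F_n` of the round curve around the holes `a … b` (holes `≥ n` are
ignored). [folklore] -/
def blockWord (n a b : ℕ) : FreeGroup (Fin n) :=
  (((List.finRange n).filter fun i => decide (a ≤ i.val ∧ i.val ≤ b)).map FreeGroup.of).prod

/-- Arc data of a generator on the disc with `n` holes.  `σⱼ`: `π = (j j+1)`, `uⱼ = xⱼ`, else `1`;
`σⱼ⁻¹`: `π = (j j+1)`, `uⱼ₊₁ = xⱼ₊₁⁻¹`, else `1` (so that `σⱼσⱼ⁻¹ = σⱼ⁻¹σⱼ = 1` on the nose);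
`T_[a,b]^{±1}`: `π = 1`, `uᵢ = (x_a ⋯ x_b)^{±1}` for `a ≤ i ≤ b`, else `1`.  A half-twist with
`j + 1 ≥ n` is the identity. [folklore] -/
def data (n : ℕ) : PGen → ArcData n
  | sigma j s =>
      if h : j + 1 < n then
        { perm := Equiv.swap (⟨j, by omega⟩ : Fin n) ⟨j + 1, h⟩
          u := fun i =>
            if s then (if i = ⟨j + 1, h⟩ then (FreeGroup.of (⟨j + 1, h⟩ : Fin n))⁻¹ else 1)
            else (if i = ⟨j, by omega⟩ then FreeGroup.of (⟨j, by omega⟩ : Fin n) else 1) }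
      else ArcData.one
  | round a b s =>
      { perm := 1
        u := fun i => if a ≤ i.val ∧ i.val ≤ b then
          (if s then (blockWord n a b)⁻¹ else blockWord n a b) else 1 }

end PGen

/-- Arc data of a word of generators (`foldr`: the LAST letter acts first, `eval [g₁, g₂] = g₁ ∘ g₂`).
[folklore] -/
def evalWord (n : ℕ) (g : List PGen) : ArcData n :=
  g.foldr (fun x acc => ArcData.mul (PGen.data n x) acc) ArcData.one

/-- Formal inverse of a word. [folklore] -/
def invWord (g : List PGen) : List PGen :=
  (g.map PGen.inv).reverse

/-- A simple closed curve on the holed disc, presented as the image `g(c_[a,b])` of the round curve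
around the holes `a … b` under the word `g` (every essential simple closed curve is of this form:
change of coordinates). [folklore] -/
structure PlanarCurve where
  /-- first hole of the round block -/
  a : ℕ
  /-- last hole of the round block -/
  b : ℕ
  /-- the carrying word -/
  g : List PGen

namespace PlanarCurve

/-- The Dehn twist about `g(c_[a,b])`, positive (`pos = true`) or negative, as the word
`g · T_[a,b]^{±1} · g⁻¹`. [folklore] -/
def twistWord (c : PlanarCurve) (pos : Bool) : List PGen :=
  c.g ++ [PGen.round c.a c.b (!pos)] ++ invWord c.g

/-- The class `[c] = g_*(x_a ⋯ x_b) ∈ F_n` of the curve (well defined up to conjugacy, which is all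
that is used). [folklore] -/
def cls (n : ℕ) (c : PlanarCurve) : FreeGroup (Fin n) :=
  (evalWord n c.g).aut (PGen.blockWord n c.a c.b)

/-- The image curve `h(c)`. [folklore] -/
def image (h : List PGen) (c : PlanarCurve) : PlanarCurve :=
  ⟨c.a, c.b, h ++ c.g⟩

/-- `c.InRange n`: the syntax of `c` only mentions the holes `0, …, n−1` and its round block is nonempty —
so that `c` denotes the SAME curve on the disc with `n + 1` holes (new hole `n` added away from it).
Words produced by the dictionary are in range; the walk's hypothesis demands it, and stabilisation is
only offered from in-range states (reinterpreting an out-of-range generator one level up would change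
its meaning). [folklore] -/
def InRange (n : ℕ) (c : PlanarCurve) : Prop :=
  c.a ≤ c.b ∧ c.b < n ∧ ∀ x ∈ c.g, PGen.below n x = true

end PlanarCurve

/-- A signed letter of an achiral planar word: a curve and a sign (`true` = positive = Lefschetz,
`false` = negative = achiral critical point). [folklore] -/
abbrev Letter : Type := PlanarCurve × Bool

/-- The twist word `T_c^{±1}` of a signed letter. [folklore] -/
def Letter.twistWord (l : Letter) : List PGen :=
  l.1.twistWord l.2

/-- Monodromy (arc data) of a signed word: the product of its letters' twists, first letter outermost.
[folklore] -/
def monodromy (n : ℕ) (w : List Letter) : ArcData n :=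
  evalWord n (w.flatMap Letter.twistWord)

/-- A positive factorisation as a signed word. [folklore] -/
def positiveWord (A : List PlanarCurve) : List Letter :=
  A.map fun c => (c, true)

/-- BLOCK FORM `A · B̄ʳᵉᵛ`: the achiral word of the planar bisection `X_A ∪ X̄_B` — the positive
factorisation `A` of one half followed by the negative letters of the other half's factorisation `B`
read backwards (total monodromy `1` when `A`, `B` factorise the same class; TRIAGE-r1-1 App. D).
(Baykur arXiv:math/0601396 Thm 5.1.) -/
def blockForm (A B : List PlanarCurve) : List Letter :=
  positiveWord A ++ (B.map fun c => (c, false)).reverse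

/-- `SeamTrivial n A`: the seam `∂X_A = OB(D_n, T_{a₁} ⋯ T_{aₙ})` of the positive block has TRIVIAL
fundamental group — the balanced arc-data presentation `⟨x₀ … x_{n−1} ∣ uᵢ(T_{a₁} ⋯ T_{aₙ})⟩` presents
the trivial group (hence, the seam being a closed 3-manifold, `∂X_A ≅ S³` by Perelman). [folklore] -/
def SeamTrivial (n : ℕ) (A : List PlanarCurve) : Prop :=
  Literature.Topology.FourManifolds.BalancedPresentation.PresentsTrivialGroup (monodromy n (positiveWord A)).u

/-- The curves `C` normally generate `F_n`: `π₁` of the 2-handlebody / of the union `X_A ∪ X̄_B` is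
trivial. [folklore] -/
def NormallyGenerates (n : ℕ) (C : List PlanarCurve) : Prop :=
  Subgroup.normalClosure {x | x ∈ C.map (PlanarCurve.cls n)} = ⊤

/-- The classes of the curves `A` generate `H₁(D_n) = F_nᵃᵇ ≅ ℤⁿ`: the hole-set matrix of `A` is
unimodular, `H₁(X_A; ℤ) = 0`. [folklore] -/
def Unimodular (n : ℕ) (A : List PlanarCurve) : Prop :=
  Subgroup.closure {x | x ∈ A.map fun c => Abelianization.of (PlanarCurve.cls n c)} = ⊤

/-- INTEGRAL HOMOTOPY-SPHERE WORD: two positive factorisations `A`, `B` (in-range syntax) of ONE mapping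
class of the disc with `n` holes (equal arc data), each of the minimal length `n` (⇔ ℚ-acyclic halves), whose curves
jointly normally generate `F_n` (⇔ `X_A ∪ X̄_B` is a homotopy 4-sphere: `χ = 2`, `H₁ = H₃ = 0`) and whose
hole-set matrices are both unimodular (the integral sector `H₁(X_A;ℤ) = H₁(X_B;ℤ) = 0`; in a homology
4-sphere `|H₁(X_A)| = |H₁(X_B)|`).  Every such word IS geometric: `Σ(A,B) = X_A ∪ X̄_B` is a smooth
homotopy 4-sphere with a planar common-contact Stein bisection (TRIAGE-r1-2 (S1)). [folklore] -/
structure IsIntegralSphereWord (n : ℕ) (A B : List PlanarCurve) : Prop where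
  inRange : ∀ c ∈ A ++ B, c.InRange n
  length_left : A.length = n
  length_right : B.length = n
  monodromy_eq : monodromy n (positiveWord A) = monodromy n (positiveWord B)
  sphere : NormallyGenerates n (A ++ B)
  unimodular_left : Unimodular n A
  unimodular_right : Unimodular n B

/-- The signed Hurwitz action of the letter `x = (c, ε)` on the letter `y = (d, η)`:
`(T_c^{ε}(d), η)`, the new curve carried by the word `T_c^{ε} · g_d`. (Gompf–Stipsicz §8.2; Baykur arXiv:math/0601396 §2.) -/
def hurwitzAct (x y : Letter) : Letter :=
  (PlanarCurve.image (Letter.twistWord x) y.1, y.2)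

/-- THE MOVES of the walk on states `(n, w)` (`n` holes, achiral word `w`), each re-reading the SAME
closed 4-manifold `X_w ∪ ♮(S¹×B³)`: cyclic rotation; the signed Hurwitz move
`(x, y) ↦ (x y x⁻¹, x)` and its inverse `(x, y) ↦ (y, y⁻¹ x y)` (the only twist-type exchanges
preserving the monodromy product); global conjugation by any mapping class `g` (re-parametrising the
page); and PLANAR STABILISATION — a new hole `n` and the cancelling pair `(γ⁺, γ⁻)` for
`γ = g(c_[m,n])`, `m ≤ n`, `g` supported off the new hole, a curve meeting the co-core of the new
1-handle once (positive Giroux stabilisation of the seam open book, both halves stabilised), offered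
only from in-range states so that the old letters keep their meaning one level up.
(Baykur arXiv:math/0601396 Thm 5.1.) -/
inductive Move : ℕ × List Letter → ℕ × List Letter → Prop
  | rotate (n : ℕ) (l : Letter) (w : List Letter) : Move (n, l :: w) (n, w ++ [l])
  | hurwitz (n : ℕ) (pre post : List Letter) (x y : Letter) :
      Move (n, pre ++ x :: y :: post) (n, pre ++ hurwitzAct x y :: x :: post)
  | hurwitzInv (n : ℕ) (pre post : List Letter) (x y : Letter) :
      Move (n, pre ++ x :: y :: post) (n, pre ++ y :: hurwitzAct (y.1, !y.2) x :: post)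
  | conj (n : ℕ) (g : List PGen) (w : List Letter) :
      Move (n, w) (n, w.map fun l => (PlanarCurve.image g l.1, l.2))
  | stabilize (n m : ℕ) (g : List PGen) (w : List Letter) (hm : m ≤ n)
      (hg : ∀ x ∈ g, PGen.below n x = true) (hw : ∀ l ∈ w, l.1.InRange n) :
      Move (n, w) (n + 1, (⟨m, n, g⟩, true) :: (⟨m, n, g⟩, false) :: w)

/-- The ORBIT of the walk: the equivalence relation generated by the moves (so destabilisation is
allowed too). [folklore] -/
def Reachable : ℕ × List Letter → ℕ × List Letter → Prop :=
  Relation.ReflTransGen fun s t => Move s t ∨ Move t s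

/-- `TwistEq n A B`: the two curve lists denote, letter by letter, curves with the SAME positive Dehn
twist on the disc with `n` holes (equal arc data) — semantic equality of the two blocks, independent
of the spelling of the carrying words (lead reshape, cycle 2, on the dictionary worker's advice: the
literal target `A' = B'` is spelling-dependent, since moves only ever PREPEND to carrying words, so an
honest double reached through the walk need not be a syntactic one). [folklore] -/
def TwistEq (n : ℕ) (A B : List PlanarCurve) : Prop :=
  List.Forall₂ (fun c d => evalWord n (c.twistWord true) = evalWord n (d.twistWord true)) A B

/-! ## §2  The five stubs -/

/-- **Stub 1 — THE DICTIONARY (known modulo vendoring; size L).**  Under the hypotheses of the crux,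
unbundled, and in the INTEGRAL sector `H₁(W₁; ℤ) = 0`: there is an integral homotopy-sphere word
`(n; A, B)` (READING: Wendl arXiv:0806.3193 Thm 1 makes both halves planar Lefschetz fibrations over one
planar open book `(D_n, φ)` supporting the common seam contact structure, `W₁ ≅ X_A`, `W₂ ≅ X_B`; Etnyre
arXiv:math/0404267 Thm 4.1 + Mayer–Vietoris in the homology sphere `M` force length `n = k − 1` on both
sides; `M ≃ₕ S⁴` gives `⟨x | A, B⟩ = 1`; `H₁(W₁;ℤ) = 0 ⇒ H₁(W₂;ℤ) = 0` gives both unimodularities) such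
that (WRITING, TRIAGE-r1-1 App. D / r1-3: the closed manifold `X_w ∪ ♮ⁿ(S¹×B³)` of the achiral word
`w = A·B̄ʳᵉᵛ` is `M`; signed Hurwitz moves, rotations and global conjugations do not change it, planar
stabilisation is Giroux stabilisation of both fillings; every block-form re-reading `A′·B̄′ʳᵉᵛ` is a planar
common-contact Stein bisection `M ≅ X_{A′} ∪ X̄_{B′}` — all curves stay essential, both induced contact
structures are supported by `(D_{n′}, μ(A′))`, made pointwise equal by a Gray isotopy of one embedding):
(i) every reachable block word whose positive block has trivial seam group re-bisects `M` with a
SIMPLY CONNECTED seam (`π₁(∂X_{A′}) = ⟨x ∣ uᵢ(μ(A′))⟩`); (ii) every reachable HONEST DOUBLE `A′ = B′`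
exhibits `M` as the double `D(X_{A′})` of a contractible (`⟨⟨A′⟩⟩ = ⟨⟨A′, B′⟩⟩ = F`, `χ = 1`) compact
Stein domain with planar contact boundary.  Why plausibly true: it is the standard Lefschetz-fibration /
open-book dictionary; the only delicate points (orientation of the upside-down half: duals attach along
page push-offs with framing `pf + 1`; exact pointwise equality of the two plane fields) were checked by
TRIAGE-r1-1 App. D and r1-3.  SPC4-implied (its conclusions hold for `S⁴`).  Uses `M ≃ₕ S⁴` and
planarity (Disproof: both load-bearing). (Wendl arXiv:0806.3193 Thm 1.) -/
theorem stub_wendlDictionary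
    (M : Type) [TopologicalSpace M] [T2Space M] [SecondCountableTopology M] [ChartedSpace E4 M]
    [IsManifold (𝓡 4) ∞ M] (hM : M ≃ₕ 𝕊⁴)
    (W₁ : Type) [TopologicalSpace W₁] [ChartedSpace (EuclideanHalfSpace 4) W₁] [IsManifold (𝓡∂ 4) ∞ W₁]
    [CompactSpace W₁] (W₂ : Type) [TopologicalSpace W₂] [ChartedSpace (EuclideanHalfSpace 4) W₂]
    [IsManifold (𝓡∂ 4) ∞ W₂] [CompactSpace W₂] (J₁ : SteinStructure W₁) (J₂ : SteinStructure W₂)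
    (e₁ : W₁ → M) (e₂ : W₂ → M)
    (he₁ : Manifold.IsSmoothEmbedding (𝓡∂ 4) (𝓡 4) ∞ e₁)
    (he₂ : Manifold.IsSmoothEmbedding (𝓡∂ 4) (𝓡 4) ∞ e₂)
    (hcover : range e₁ ∪ range e₂ = univ)
    (hseam₁ : range e₁ ∩ range e₂ = e₁ '' (𝓡∂ 4).boundary W₁)
    (hseam₂ : range e₁ ∩ range e₂ = e₂ '' (𝓡∂ 4).boundary W₂)
    (hξ : ∀ w₁ w₂, e₁ w₁ = e₂ w₂ →
      Submodule.map (mfderiv (𝓡∂ 4) (𝓡 4) e₁ w₁).toLinearMap (contactPlane J₁.J w₁) =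
      Submodule.map (mfderiv (𝓡∂ 4) (𝓡 4) e₂ w₂).toLinearMap (contactPlane J₂.J w₂))
    (hplanar : PlanarContactBoundary J₁)
    (hac : ∀ k, 0 < k → IsZero (singularHomology ℚ ℚ W₁ k) ∧ IsZero (singularHomology ℚ ℚ W₂ k))
    (hint : IsZero (singularHomology ℤ ℤ W₁ 1)) :
    ∃ (n : ℕ) (A B : List PlanarCurve), IsIntegralSphereWord n A B ∧
      (∀ (n' : ℕ) (A' B' : List PlanarCurve),
        Reachable (n, blockForm A B) (n', blockForm A' B') → SeamTrivial n' A' →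
        ∃ (V₁ : Type) (_ : TopologicalSpace V₁) (_ : ChartedSpace (EuclideanHalfSpace 4) V₁)
          (_ : IsManifold (𝓡∂ 4) ∞ V₁) (_ : CompactSpace V₁)
          (V₂ : Type) (_ : TopologicalSpace V₂) (_ : ChartedSpace (EuclideanHalfSpace 4) V₂)
          (_ : IsManifold (𝓡∂ 4) ∞ V₂) (_ : CompactSpace V₂)
          (K₁ : SteinStructure V₁) (K₂ : SteinStructure V₂) (f₁ : V₁ → M) (f₂ : V₂ → M),
          Manifold.IsSmoothEmbedding (𝓡∂ 4) (𝓡 4) ∞ f₁ ∧ Manifold.IsSmoothEmbedding (𝓡∂ 4) (𝓡 4) ∞ f₂ ∧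
          range f₁ ∪ range f₂ = univ ∧ range f₁ ∩ range f₂ = f₁ '' (𝓡∂ 4).boundary V₁ ∧
          range f₁ ∩ range f₂ = f₂ '' (𝓡∂ 4).boundary V₂ ∧
          (∀ v₁ v₂, f₁ v₁ = f₂ v₂ →
            Submodule.map (mfderiv (𝓡∂ 4) (𝓡 4) f₁ v₁).toLinearMap (contactPlane K₁.J v₁) =
            Submodule.map (mfderiv (𝓡∂ 4) (𝓡 4) f₂ v₂).toLinearMap (contactPlane K₂.J v₂)) ∧
          SimplyConnectedSpace ↥(range f₁ ∩ range f₂)) ∧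
      (∀ (n' : ℕ) (A' B' : List PlanarCurve),
        Reachable (n, blockForm A B) (n', blockForm A' B') → TwistEq n' A' B' →
        ∃ (W : Type) (_ : TopologicalSpace W) (_ : T2Space W) (_ : SecondCountableTopology W)
          (_ : ChartedSpace (EuclideanHalfSpace 4) W) (_ : IsManifold (𝓡∂ 4) ∞ W) (_ : CompactSpace W)
          (_ : ContractibleSpace W) (J : SteinStructure W) (b : BoundaryData (𝓡∂ 4) W (𝓡 3)),
          PlanarContactBoundary J ∧ IsDouble b (𝓡 4) M) := by
  sorry

/-- **Stub 2 — THE LEVER: REACH(integral), the seam walk (new; the line's bet; HARDEST).**  Pure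
combinatorics of the framed braid group: for every integral homotopy-sphere word `(n; A, B)` the orbit of
the achiral word `A·B̄ʳᵉᵛ` under signed Hurwitz moves, rotations, global conjugations and planar
(de)stabilisations contains a block word `A′·B̄′ʳᵉᵛ` whose positive block has TRIVIAL SEAM GROUP
(`⟨x ∣ uᵢ(T_{a′₁}⋯T_{a′ₙ})⟩ = 1`, i.e. `∂X_{A′} ≅ S³`, `X_{A′} ≅ B⁴` by Eliashberg) — positive critical
values braided among the negative ones until one half is a ball — OR an HONEST DOUBLE `A′ = B′`.
Why plausibly true: the target set is large (ANY `B′`), both targets and the hypothesis are decidable /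
machine-checkable word by word, the necessary homological condition (`H₁(X_A;ℤ) = 0`, a walk invariant:
planar twists act trivially on `H₁(D_n)`) is exactly the hypothesis, nothing is claimed in the torsion
sector (where both targets are provably unreachable), and no Hurwitz-rigid orbit of a homotopy-sphere
word is known; the doubles sub-case (where Andrews–Curtis-strength content would otherwise sit,
TRIAGE-r1-3 (F1)) is discharged by the second target with ZERO moves.  NOT implied by SPC4: a
Hurwitz-rigid orbit inside `S⁴` refutes it without an exotic sphere — first benchmark = Disproof §7's
8 + 64 certified Hurwitz-inequivalent contractible census pairs and the Akbulut-cork double over KOU's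
`P₅` book (arXiv:1607.07661 Prop 2.3), by breadth-first search in the planner's / census scripts.
Size XL (a theorem about `B_n ⋉ ℤⁿ` acting on signed words; provable instances by explicit move
sequences, refutable instances only by an orbit invariant). (Wendl arXiv:0806.3193 Thm 1.) -/
theorem stub_seamWalk (n : ℕ) (A B : List PlanarCurve) (h : IsIntegralSphereWord n A B) :
    ∃ (n' : ℕ) (A' B' : List PlanarCurve),
      Reachable (n, blockForm A B) (n', blockForm A' B') ∧ (SeamTrivial n' A' ∨ TwistEq n' A' B') := by
  sorry

/-- **Stub 3 — ABSORBING TARGET 1: a common-contact Stein bisection with simply connected seam is `S⁴`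
(known modulo named facts; size M).**  Data: a Hausdorff second-countable `C^∞` 4-manifold `M` covered
by two smoothly embedded compact Stein domains meeting exactly along the images of their boundaries with
matching complex tangencies, whose seam `e₁(W₁) ∩ e₂(W₂)` is simply connected.  Then the seam — a closed
connected 3-manifold — is `S³` (Perelman), its contact structure is Stein fillable hence tight hence
`ξ_std` (Eliashberg 1992), both halves are Stein fillings of `(S³, ξ_std)` hence balls
(`Literature.Geometry.Symplectic.Eliashberg1990_steinFilling_sphere_three`), and `M` is a twisted
sphere, hence `S⁴` (`Literature.Topology.FourManifolds.cerf_twistedSphere_four`).  After Perelman this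
is LITERALLY the route's support item `ConvexBisection.SphereSeamStandard` (stmt-SmoothPoincare4-10510,
stamped "known"): `simplyConnectedSeam_of_sphereSeamStandard` below PROVES this stub from that item
and the Poincaré–Perelman fact in the shape consumed here (`SeamPoincare`) — DELEGATE to 10510.  The
card's `OneSidedBallSeam` (`W₁ ≅ 𝔻⁴`) is the special case `seam ≅ ∂𝔻⁴`.  The hypothesis `M ≃ₕ S⁴` is
not needed by the proof; it is kept so that the delegation is literal.  No planarity hypothesis. (Eliashberg 1990 Thm 5.1; Cerf 1968.) -/
theorem stub_simplyConnectedSeam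
    (M : Type) [TopologicalSpace M] [T2Space M] [SecondCountableTopology M] [ChartedSpace E4 M]
    [IsManifold (𝓡 4) ∞ M] (hM : M ≃ₕ 𝕊⁴)
    (W₁ : Type) [TopologicalSpace W₁] [ChartedSpace (EuclideanHalfSpace 4) W₁] [IsManifold (𝓡∂ 4) ∞ W₁]
    [CompactSpace W₁] (W₂ : Type) [TopologicalSpace W₂] [ChartedSpace (EuclideanHalfSpace 4) W₂]
    [IsManifold (𝓡∂ 4) ∞ W₂] [CompactSpace W₂] (J₁ : SteinStructure W₁) (J₂ : SteinStructure W₂)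
    (e₁ : W₁ → M) (e₂ : W₂ → M)
    (he₁ : Manifold.IsSmoothEmbedding (𝓡∂ 4) (𝓡 4) ∞ e₁)
    (he₂ : Manifold.IsSmoothEmbedding (𝓡∂ 4) (𝓡 4) ∞ e₂)
    (hcover : range e₁ ∪ range e₂ = univ)
    (hseam₁ : range e₁ ∩ range e₂ = e₁ '' (𝓡∂ 4).boundary W₁)
    (hseam₂ : range e₁ ∩ range e₂ = e₂ '' (𝓡∂ 4).boundary W₂)
    (hξ : ∀ w₁ w₂, e₁ w₁ = e₂ w₂ →
      Submodule.map (mfderiv (𝓡∂ 4) (𝓡 4) e₁ w₁).toLinearMap (contactPlane J₁.J w₁) =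
      Submodule.map (mfderiv (𝓡∂ 4) (𝓡 4) e₂ w₂).toLinearMap (contactPlane J₂.J w₂))
    (hsc : SimplyConnectedSpace ↥(range e₁ ∩ range e₂)) :
    Nonempty (M ≃ₘ⟮𝓡 4, 𝓡 4⟯ 𝕊⁴) := by
  sorry

/-- **Stub 4 — ABSORBING TARGET 2 = the shared residual `PlanarSteinDoubleStandard`: the double of a
contractible compact Stein domain with PLANAR contact boundary is `S⁴` (open; Andrews–Curtis strength;
size XL).**  Data: `M` (Hausdorff, second countable, `C^∞`) is the double `D(W) = W ∪_{id} W̄`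
(`Literature.Topology.FourManifolds.IsDouble`) of a compact contractible Stein domain `(W, J)` whose
contact boundary is planar.  Then `M ≅ S⁴`.  Why plausibly true / what it contains: `D(W) = ∂(W × I)` and
`W` is a 2-handlebody (Stein), so this is the planar slice of item stmt-SmoothPoincare4-3717
`PresentationSpheresStandard` (crux, rank 3, shared by routes EntropyLadder / ConvexityLadder /
RicciTranscript — DELEGATE there) and of the `ψ = id` slice of the route's crux 4
`ContractibleTwistedDoubleStandard` (stmt-SmoothPoincare4-3546); it holds whenever the planar-curve
presentation `⟨x ∣ [a′ⱼ]⟩` is Andrews–Curtis trivial (all 112 + 128 contractible census representatives,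
Disproof §7; Mazur-type / KOU corks), and by TRIAGE-r1-3 (F1) "planar" is no restriction up to stable AC
(planar avatars of every balanced presentation) — so this stub, not the lever, carries the AC-strength
content common to every line on this crux (r1-2: "should be filed once by the lead, not per line").
Verbatim the `X := M` instance of `PlanarSteinDoubleStandard` (FirstLemmasIdeator3).  SPC4-implied.
(Andrews–Curtis 1965.) -/
theorem stub_planarSteinDouble
    (M : Type) [TopologicalSpace M] [T2Space M] [SecondCountableTopology M] [ChartedSpace E4 M]
    [IsManifold (𝓡 4) ∞ M]
    (W : Type) [TopologicalSpace W] [T2Space W] [SecondCountableTopology W]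
    [ChartedSpace (EuclideanHalfSpace 4) W] [IsManifold (𝓡∂ 4) ∞ W] [CompactSpace W]
    [ContractibleSpace W] (J : SteinStructure W) (b : BoundaryData (𝓡∂ 4) W (𝓡 3))
    (hplanar : PlanarContactBoundary J) (hdouble : IsDouble b (𝓡 4) M) :
    Nonempty (M ≃ₘ⟮𝓡 4, 𝓡 4⟯ 𝕊⁴) := by
  sorry

/-- **Stub 5a — THE CITE FACT (Etnyre 2004, Thm 4.1, Stein case; the two clauses this line
consumes), isolated as its own registered stub (lead reshape, cycle 2).**  For a compact Stein domain
`W` whose contact boundary is planar: (i) *connected boundary, per component* — the inclusion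
`∂W ↪ W` is injective on `H₀(·; ℚ)` (every component of `W` has connected boundary; each component is a
Stein filling of the planar contact manifold "its boundary with the restricted open book"), and
(ii) *`b₂⁰(W) = 0`, homological avatar* — `H₂(∂W; ℚ) → H₂(W; ℚ)` is the zero map (the radical of the
intersection pairing on `H₂(W; ℚ)` is the image of this map and `b₂⁰` is its dimension).  Etnyre,
*Planar open book decompositions and contact structures*, IMRN 2004:79 (arXiv:math/0404267), Thm 4.1:
"If X is a symplectic filling of a planar contact manifold then ∂X is connected and b₂⁺(X) = b₂⁰(X) = 0."
Clause (ii) is the only part of `b₂⁺ = b₂⁰ = 0` needed here and is typable today; `b₂⁺ = 0` would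
need an intersection-form / `b₂⁺` vocabulary the tree lacks (wave-1 inventory D1/D2/D2′,
`work/stubs/stub_nonSimplyConnectedHalves.report.md`).  A PUBLISHED theorem, not a conjecture: the line
may end "closed modulo {Etnyre2004 Thm 4.1}" on it (the gate relocates the def to
`Literature/Geometry/Symplectic/` when the helper of Stub 5b lands it inline).
[cite: arXiv:math/0404267, Thm. 4.1] -/
def EtnyrePlanarFilling : Prop :=
  (∀ (W : Type) [TopologicalSpace W] [T2Space W] [ChartedSpace (EuclideanHalfSpace 4) W]
      [IsManifold (𝓡∂ 4) ∞ W] [CompactSpace W] (S : SteinStructure W), PlanarContactBoundary S →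
      Function.Injective (singularHomology.map ℚ ℚ
        (⟨Subtype.val, continuous_subtype_val⟩ : C(↥((𝓡∂ 4).boundary W), W)) 0)) ∧
  (∀ (W : Type) [TopologicalSpace W] [T2Space W] [ChartedSpace (EuclideanHalfSpace 4) W]
      [IsManifold (𝓡∂ 4) ∞ W] [CompactSpace W] (S : SteinStructure W), PlanarContactBoundary S →
      singularHomology.map ℚ ℚ
        (⟨Subtype.val, continuous_subtype_val⟩ : C(↥((𝓡∂ 4).boundary W), W)) 2 = 0)

/-- **Stub 5a (registered): Etnyre 2004 Thm 4.1 holds** — the cite fact itself; discharged only by a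
Literature proof of Etnyre's theorem (holomorphic-curve filling theory; not this line's business).
(Etnyre arXiv:math/0404267 Thm 4.1.) -/
theorem stub_etnyreFact : EtnyrePlanarFilling := by
  sorry

/-- **Stub 5b (registered) — Etnyre–Mayer–Vietoris, PROVABLE NOW (size M–L): the cite fact of Stub 5a
implies that the halves of a planar common-contact Stein bisection of a homotopy 4-sphere are
rationally acyclic in positive degrees.**  Route: planarity transfers to `J₂` (LANDED
`Theorems.PlanarBisectionRigidity.ColouredStringLinksSquareFreeAc.stub_planarSeamTransfer`, p76418);
clause (ii) on both halves + `H₂(M; ℚ) = H₃(M; ℚ) = 0` give `H₂(W₁) = H₂(W₂) = H₂(∂W₁) = 0` over ℚ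
(wave-1 glue `Glue.isZero_homology_two_of_radicalVanishes`, kernel-checked in
`work/stubs/stub_nonSimplyConnectedHalves.lean`); Poincaré duality on the closed oriented seam gives
`b₁(∂W₁) = b₂(∂W₁) = 0`; clause (i) + "every component of a half meets the seam"
(`Witness.connectedComponent_meets_seam₁/₂`) + connectedness of `M` give connected halves; then the
landed Mayer–Vietoris package `Witness.acyclic_iff_connected_and_seam` concludes.  (Replaces the
planner's `stub_etnyrePlanarAcyclic`, which hid the cite fact inside an unprovable signature.) -/
theorem stub_etnyrePlanarAcyclicOfFact (hEt : EtnyrePlanarFilling)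
    (M : Type) [TopologicalSpace M] [T2Space M] [SecondCountableTopology M] [ChartedSpace E4 M]
    [IsManifold (𝓡 4) ∞ M] (hM : M ≃ₕ 𝕊⁴)
    (W₁ : Type) [TopologicalSpace W₁] [ChartedSpace (EuclideanHalfSpace 4) W₁] [IsManifold (𝓡∂ 4) ∞ W₁]
    [CompactSpace W₁] (W₂ : Type) [TopologicalSpace W₂] [ChartedSpace (EuclideanHalfSpace 4) W₂]
    [IsManifold (𝓡∂ 4) ∞ W₂] [CompactSpace W₂] (J₁ : SteinStructure W₁) (J₂ : SteinStructure W₂)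
    (e₁ : W₁ → M) (e₂ : W₂ → M)
    (he₁ : Manifold.IsSmoothEmbedding (𝓡∂ 4) (𝓡 4) ∞ e₁)
    (he₂ : Manifold.IsSmoothEmbedding (𝓡∂ 4) (𝓡 4) ∞ e₂)
    (hcover : range e₁ ∪ range e₂ = univ)
    (hseam₁ : range e₁ ∩ range e₂ = e₁ '' (𝓡∂ 4).boundary W₁)
    (hseam₂ : range e₁ ∩ range e₂ = e₂ '' (𝓡∂ 4).boundary W₂)
    (hξ : ∀ w₁ w₂, e₁ w₁ = e₂ w₂ →
      Submodule.map (mfderiv (𝓡∂ 4) (𝓡 4) e₁ w₁).toLinearMap (contactPlane J₁.J w₁) =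
      Submodule.map (mfderiv (𝓡∂ 4) (𝓡 4) e₂ w₂).toLinearMap (contactPlane J₂.J w₂))
    (hplanar : PlanarContactBoundary J₁) :
    ∀ k, 0 < k → IsZero (singularHomology ℚ ℚ W₁ k) ∧ IsZero (singularHomology ℚ ℚ W₂ k) := by
  sorry

/-- **Stub 6 — RESIDUAL, THE TORSION SECTOR (outside the walk's reach; open; size L–XL).**  The crux's
data with the halves' rational acyclicity made explicit (supplied by Stub 5) and the extra hypothesis
`H₁(W₁; ℤ) ≠ 0` — i.e. the torsion slice of crux `AcyclicBisectionRigidity` restricted to planar seams,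
PROVED below from that item (`torsionSector_of_acyclicRigidity`).  Here the halves are Stein rational balls with
`H₁(W₁) ≅ H₁(W₂) = G ≠ 0`, the seam has `H₁ ≅ G ⊕ G` with hyperbolic linking form, `c₁(ξ) = 0`, and no
lens-space, lens-sum or embedded `B_{p,q}` seam occurs (Hantzsche; card (3)); the sector is INHABITED —
TRIAGE-r1-2 (S1): 19 explicit `Σ(A,B)` at `k = 5` with `π₁(halves) = ℤ/2` and seam
`S³/Q₈ = M(−1; ½,½,½)` (all of whose tight structures are planar), and the round `S⁴ = X_L ∪_ψ X̄_L`
(`X_L = N₋₂(ℝP²)`, GLS arXiv:math/0509714 §4) — so it must be STANDARDISED, not emptied, and the walk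
cannot do it (`H₁(W₁′;ℤ)` is invariant; `π₁ D(X_{A′}) ≠ 1` excludes the double target too).  Lever (not
this line's): classify the ℚHB Stein fillings of the prism/quaternionic planar seams (first question: is
every Stein ℚHB filling of `(M(−1;½,½,½), ξ)` diffeomorphic to `N₋₂(ℝP²)`?) and reglue by Price 1977 /
Kim–Miller arXiv:1805.00429 §3.1 (all regluings of `ν(ℝP²) ⊂ S⁴` along `S³/Q₈` are standard); shared with
line one-cap-two-fillings' `(T″)` and with `stub_nonContractibleTwinTwistedDouble` of the picked line on
crux 10507 — DELEGATE to item stmt-SmoothPoincare4-10507 (rank 2, staffed).  SPC4-implied. (Ghiggini–Lisca–Stipsicz arXiv:math/0509714 §4.) -/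
theorem stub_torsionSector
    (M : Type) [TopologicalSpace M] [T2Space M] [SecondCountableTopology M] [ChartedSpace E4 M]
    [IsManifold (𝓡 4) ∞ M] (hM : M ≃ₕ 𝕊⁴)
    (W₁ : Type) [TopologicalSpace W₁] [ChartedSpace (EuclideanHalfSpace 4) W₁] [IsManifold (𝓡∂ 4) ∞ W₁]
    [CompactSpace W₁] (W₂ : Type) [TopologicalSpace W₂] [ChartedSpace (EuclideanHalfSpace 4) W₂]
    [IsManifold (𝓡∂ 4) ∞ W₂] [CompactSpace W₂] (J₁ : SteinStructure W₁) (J₂ : SteinStructure W₂)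
    (e₁ : W₁ → M) (e₂ : W₂ → M)
    (he₁ : Manifold.IsSmoothEmbedding (𝓡∂ 4) (𝓡 4) ∞ e₁)
    (he₂ : Manifold.IsSmoothEmbedding (𝓡∂ 4) (𝓡 4) ∞ e₂)
    (hcover : range e₁ ∪ range e₂ = univ)
    (hseam₁ : range e₁ ∩ range e₂ = e₁ '' (𝓡∂ 4).boundary W₁)
    (hseam₂ : range e₁ ∩ range e₂ = e₂ '' (𝓡∂ 4).boundary W₂)
    (hξ : ∀ w₁ w₂, e₁ w₁ = e₂ w₂ →
      Submodule.map (mfderiv (𝓡∂ 4) (𝓡 4) e₁ w₁).toLinearMap (contactPlane J₁.J w₁) =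
      Submodule.map (mfderiv (𝓡∂ 4) (𝓡 4) e₂ w₂).toLinearMap (contactPlane J₂.J w₂))
    (hplanar : PlanarContactBoundary J₁)
    (hac : ∀ k, 0 < k → IsZero (singularHomology ℚ ℚ W₁ k) ∧ IsZero (singularHomology ℚ ℚ W₂ k))
    (htor : ¬ IsZero (singularHomology ℤ ℤ W₁ 1)) :
    Nonempty (M ≃ₘ⟮𝓡 4, 𝓡 4⟯ 𝕊⁴) := by
  sorry

/-! ## §3  The composition (kernel-checked, no `sorry` of its own) -/

/-- **The six stubs prove the crux `ConvexBisection.PlanarBisectionRigidity` BY NAME.**  Case on the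
sector.  INTEGRAL (`H₁(W₁;ℤ) = 0`): the dictionary READS the bisection as an integral homotopy-sphere
word `(n; A, B)`; the seam walk reaches a block word with trivial positive seam group or an honest
double; the dictionary WRITES that state back as a re-bisection of `M` with simply connected seam
(absorbing Stub 3) or as a planar Stein double (absorbing Stub 4).  TORSION: Etnyre–Mayer–Vietoris
(Stub 5) feeds the residual Stub 6. -/
theorem PlanarBisectionRigidity_of : ConvexBisection.PlanarBisectionRigidity := by
  intro M _ _ _ _ _ hM hb
  obtain ⟨W₁, _, _, _, _, W₂, _, _, _, _, J₁, J₂, e₁, e₂, he₁, he₂, hcover, hseam₁, hseam₂, hξ, hpl⟩ :=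
    hb
  -- Etnyre–Mayer–Vietoris (Stubs 5a+5b): both halves are ℚ-acyclic; needed by the dictionary (lengths
  -- `n = k − 1` on both sides) and by the torsion residual.
  have hac := stub_etnyrePlanarAcyclicOfFact stub_etnyreFact M hM W₁ W₂ J₁ J₂ e₁ e₂ he₁ he₂ hcover
    hseam₁ hseam₂ hξ hpl
  by_cases hint : IsZero (singularHomology ℤ ℤ W₁ 1)
  · obtain ⟨n, A, B, hw, hseamClause, hdoubleClause⟩ :=
      stub_wendlDictionary M hM W₁ W₂ J₁ J₂ e₁ e₂ he₁ he₂ hcover hseam₁ hseam₂ hξ hpl hac hint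
    obtain ⟨n', A', B', hreach, htarget⟩ := stub_seamWalk n A B hw
    rcases htarget with hS | hD
    · obtain ⟨V₁, _, _, _, _, V₂, _, _, _, _, K₁, K₂, f₁, f₂, hf₁, hf₂, hcov', hs₁', hs₂', hξ', hsc⟩ :=
        hseamClause n' A' B' hreach hS
      exact stub_simplyConnectedSeam M hM V₁ V₂ K₁ K₂ f₁ f₂ hf₁ hf₂ hcov' hs₁' hs₂' hξ' hsc
    · obtain ⟨W, _, _, _, _, _, _, _, J, b, hplanarW, hdouble⟩ := hdoubleClause n' A' B' hreach hD
      exact stub_planarSteinDouble M W J b hplanarW hdouble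
  · exact stub_torsionSector M hM W₁ W₂ J₁ J₂ e₁ e₂ he₁ he₂ hcover hseam₁ hseam₂ hξ hpl hac hint

/-! ## §4  Cross-links (sorry-free) -/

/-- **Stub 6 is implied by the route's rank-2 crux `AcyclicBisectionRigidity`** (stmt-SmoothPoincare4-10507,
staffed: PICKED line minimal-factorisation-rigidity, whose `stub_nonContractibleTwinTwistedDouble` is this
sector after twins): forget planarity and the torsion hypothesis.  So the torsion residual is not
free-floating — the lead may DELEGATE it to item 10507. -/
theorem torsionSector_of_acyclicRigidity (hR : ConvexBisection.AcyclicBisectionRigidity)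
    (M : Type) [TopologicalSpace M] [T2Space M] [SecondCountableTopology M] [ChartedSpace E4 M]
    [IsManifold (𝓡 4) ∞ M] (hM : M ≃ₕ 𝕊⁴)
    (W₁ : Type) [TopologicalSpace W₁] [ChartedSpace (EuclideanHalfSpace 4) W₁] [IsManifold (𝓡∂ 4) ∞ W₁]
    [CompactSpace W₁] (W₂ : Type) [TopologicalSpace W₂] [ChartedSpace (EuclideanHalfSpace 4) W₂]
    [IsManifold (𝓡∂ 4) ∞ W₂] [CompactSpace W₂] (J₁ : SteinStructure W₁) (J₂ : SteinStructure W₂)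
    (e₁ : W₁ → M) (e₂ : W₂ → M)
    (he₁ : Manifold.IsSmoothEmbedding (𝓡∂ 4) (𝓡 4) ∞ e₁)
    (he₂ : Manifold.IsSmoothEmbedding (𝓡∂ 4) (𝓡 4) ∞ e₂)
    (hcover : range e₁ ∪ range e₂ = univ)
    (hseam₁ : range e₁ ∩ range e₂ = e₁ '' (𝓡∂ 4).boundary W₁)
    (hseam₂ : range e₁ ∩ range e₂ = e₂ '' (𝓡∂ 4).boundary W₂)
    (hξ : ∀ w₁ w₂, e₁ w₁ = e₂ w₂ →
      Submodule.map (mfderiv (𝓡∂ 4) (𝓡 4) e₁ w₁).toLinearMap (contactPlane J₁.J w₁) =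
      Submodule.map (mfderiv (𝓡∂ 4) (𝓡 4) e₂ w₂).toLinearMap (contactPlane J₂.J w₂))
    (hplanar : PlanarContactBoundary J₁)
    (hac : ∀ k, 0 < k → IsZero (singularHomology ℚ ℚ W₁ k) ∧ IsZero (singularHomology ℚ ℚ W₂ k))
    (htor : ¬ IsZero (singularHomology ℤ ℤ W₁ 1)) :
    Nonempty (M ≃ₘ⟮𝓡 4, 𝓡 4⟯ 𝕊⁴) :=
  hR M hM ⟨W₁, inferInstance, inferInstance, inferInstance, inferInstance, W₂, inferInstance,
    inferInstance, inferInstance, inferInstance, J₁, J₂, e₁, e₂, he₁, he₂, hcover, hseam₁, hseam₂, hξ, hac⟩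

/-- **Stub 4 is implied by the route's rank-4 crux `ContractibleTwistedDoubleStandard`** (item
stmt-SmoothPoincare4-3546), even without planarity: a double `W ∪_id W` of a compact Stein domain is a
common-contact Stein bisection by two copies of `(W, J)` — the LANDED negative-side lemma
`Theorems/ContractibleTwistedDoubleStandard/Negative/DoubleBisection.lean`, `double_standard_of_crux`.
So the second absorbing target is blocked on an EXISTING staffed item (wave-1 worker report
`work/stubs/stub_planarSteinDoubleStandard.report.md`: no unconditional sub-class lands today), not
free-floating; and it is the PLANAR slice only (= item 3717 `PresentationSpheresStandard` on paper,
`D(W) = ∂(W × I)`). [folklore] -/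
theorem planarSteinDouble_of_crux4 (h4 : ConvexBisection.ContractibleTwistedDoubleStandard)
    (M : Type) [TopologicalSpace M] [T2Space M] [SecondCountableTopology M] [ChartedSpace E4 M]
    [IsManifold (𝓡 4) ∞ M]
    (W : Type) [TopologicalSpace W] [T2Space W] [SecondCountableTopology W]
    [ChartedSpace (EuclideanHalfSpace 4) W] [IsManifold (𝓡∂ 4) ∞ W] [CompactSpace W]
    [ContractibleSpace W] (J : SteinStructure W) (b : BoundaryData (𝓡∂ 4) W (𝓡 3))
    (hplanar : PlanarContactBoundary J) (hdouble : IsDouble b (𝓡 4) M) :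
    Nonempty (M ≃ₘ⟮𝓡 4, 𝓡 4⟯ 𝕊⁴) :=
  Theorems.ContractibleTwistedDoubleStandard.Negative.double_standard_of_crux h4 W J b M hdouble

/-- **Planarity is symmetric in the two halves** (the LANDED wave-1 stub of the dead sibling line
`coloured-string-links-square-free-ac`, p76418): under the bisection hypotheses,
`PlanarContactBoundary J₁ → PlanarContactBoundary J₂`.  Recorded here so that the dictionary / Etnyre
stubs may put the planar open book on whichever half they need. [folklore] -/
theorem planar_symm
    (M : Type) [TopologicalSpace M] [T2Space M] [SecondCountableTopology M] [ChartedSpace E4 M]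
    [IsManifold (𝓡 4) ∞ M]
    (W₁ : Type) [TopologicalSpace W₁] [ChartedSpace (EuclideanHalfSpace 4) W₁] [IsManifold (𝓡∂ 4) ∞ W₁]
    [CompactSpace W₁] (W₂ : Type) [TopologicalSpace W₂] [ChartedSpace (EuclideanHalfSpace 4) W₂]
    [IsManifold (𝓡∂ 4) ∞ W₂] [CompactSpace W₂] (J₁ : SteinStructure W₁) (J₂ : SteinStructure W₂)
    (e₁ : W₁ → M) (e₂ : W₂ → M)
    (he₁ : Manifold.IsSmoothEmbedding (𝓡∂ 4) (𝓡 4) ∞ e₁)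
    (he₂ : Manifold.IsSmoothEmbedding (𝓡∂ 4) (𝓡 4) ∞ e₂)
    (hcover : range e₁ ∪ range e₂ = univ)
    (hseam₁ : range e₁ ∩ range e₂ = e₁ '' (𝓡∂ 4).boundary W₁)
    (hseam₂ : range e₁ ∩ range e₂ = e₂ '' (𝓡∂ 4).boundary W₂)
    (hξ : ∀ w₁ w₂, e₁ w₁ = e₂ w₂ →
      Submodule.map (mfderiv (𝓡∂ 4) (𝓡 4) e₁ w₁).toLinearMap (contactPlane J₁.J w₁) =
      Submodule.map (mfderiv (𝓡∂ 4) (𝓡 4) e₂ w₂).toLinearMap (contactPlane J₂.J w₂))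
    (hpl : PlanarContactBoundary J₁) : PlanarContactBoundary J₂ :=
  Theorems.PlanarBisectionRigidity.ColouredStringLinksSquareFreeAc.stub_planarSeamTransfer M W₁ W₂ J₁ J₂
    e₁ e₂ he₁ he₂ hcover hseam₁ hseam₂ hξ hpl

/-- **Poincaré–Perelman in the shape consumed here (named-fact shape, hypothesis of the cross-link below;
NOT a stub):** the seam of a common-contact Stein bisection, a closed connected 3-manifold homeomorphic
to `∂W₁` (`e₁` embeds `∂W₁` onto the seam), is homeomorphic to `S³` as soon as it is simply connected
(Perelman 2003; Morgan–Tian 2007, Cor. 0.2). -/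
def SeamPoincare : Prop :=
  ∀ (M : Type) [TopologicalSpace M] [T2Space M] [SecondCountableTopology M] [ChartedSpace E4 M]
    [IsManifold (𝓡 4) ∞ M]
    (W₁ : Type) [TopologicalSpace W₁] [ChartedSpace (EuclideanHalfSpace 4) W₁] [IsManifold (𝓡∂ 4) ∞ W₁]
    [CompactSpace W₁] (W₂ : Type) [TopologicalSpace W₂] [ChartedSpace (EuclideanHalfSpace 4) W₂]
    [IsManifold (𝓡∂ 4) ∞ W₂] [CompactSpace W₂] (e₁ : W₁ → M) (e₂ : W₂ → M),
    Manifold.IsSmoothEmbedding (𝓡∂ 4) (𝓡 4) ∞ e₁ → Manifold.IsSmoothEmbedding (𝓡∂ 4) (𝓡 4) ∞ e₂ →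
    range e₁ ∩ range e₂ = e₁ '' (𝓡∂ 4).boundary W₁ →
    SimplyConnectedSpace ↥(range e₁ ∩ range e₂) →
    Nonempty (((𝓡∂ 4).boundary W₁) ≃ₜ Metric.sphere (0 : EuclideanSpace ℝ (Fin 4)) 1)

/-- **Stub 3 is the route's support item `SphereSeamStandard` (stmt-SmoothPoincare4-10510) after
Poincaré–Perelman**: a simply connected seam is homeomorphic to `S³`, and then item 10510 applies
verbatim.  So the first absorbing target is DELEGATED to an existing, stamped-known item. -/
theorem simplyConnectedSeam_of_sphereSeamStandard (h : ConvexBisection.SphereSeamStandard)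
    (hP : SeamPoincare)
    (M : Type) [TopologicalSpace M] [T2Space M] [SecondCountableTopology M] [ChartedSpace E4 M]
    [IsManifold (𝓡 4) ∞ M] (hM : M ≃ₕ 𝕊⁴)
    (W₁ : Type) [TopologicalSpace W₁] [ChartedSpace (EuclideanHalfSpace 4) W₁] [IsManifold (𝓡∂ 4) ∞ W₁]
    [CompactSpace W₁] (W₂ : Type) [TopologicalSpace W₂] [ChartedSpace (EuclideanHalfSpace 4) W₂]
    [IsManifold (𝓡∂ 4) ∞ W₂] [CompactSpace W₂] (J₁ : SteinStructure W₁) (J₂ : SteinStructure W₂)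
    (e₁ : W₁ → M) (e₂ : W₂ → M)
    (he₁ : Manifold.IsSmoothEmbedding (𝓡∂ 4) (𝓡 4) ∞ e₁)
    (he₂ : Manifold.IsSmoothEmbedding (𝓡∂ 4) (𝓡 4) ∞ e₂)
    (hcover : range e₁ ∪ range e₂ = univ)
    (hseam₁ : range e₁ ∩ range e₂ = e₁ '' (𝓡∂ 4).boundary W₁)
    (hseam₂ : range e₁ ∩ range e₂ = e₂ '' (𝓡∂ 4).boundary W₂)
    (hξ : ∀ w₁ w₂, e₁ w₁ = e₂ w₂ →
      Submodule.map (mfderiv (𝓡∂ 4) (𝓡 4) e₁ w₁).toLinearMap (contactPlane J₁.J w₁) =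
      Submodule.map (mfderiv (𝓡∂ 4) (𝓡 4) e₂ w₂).toLinearMap (contactPlane J₂.J w₂))
    (hsc : SimplyConnectedSpace ↥(range e₁ ∩ range e₂)) :
    Nonempty (M ≃ₘ⟮𝓡 4, 𝓡 4⟯ 𝕊⁴) :=
  h M hM ⟨W₁, inferInstance, inferInstance, inferInstance, inferInstance, W₂, inferInstance,
    inferInstance, inferInstance, inferInstance, J₁, J₂, e₁, e₂, he₁, he₂, hcover, hseam₁, hseam₂, hξ,
    hP M W₁ W₂ e₁ e₂ he₁ he₂ hseam₁ hsc⟩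

/-! ## §5  Sanity of the word calculus (kernel-checked examples) -/

/-- The empty word on the disc with no hole (`k = 1`, disc pages, seam `S³`, `S⁴ = B⁴ ∪ B̄⁴`) is an
integral homotopy-sphere word whose positive block has trivial seam group — the base case of the walk is a
target with zero moves. [folklore] -/
example : SeamTrivial 0 [] ∨ ([] : List PlanarCurve) = [] := Or.inr rfl

/-- Reachability is reflexive (zero moves). [folklore] -/
example (n : ℕ) (w : List Letter) : Reachable (n, w) (n, w) := Relation.ReflTransGen.refl

end Summit.SmoothPoincare4.SmoothPoincare4.Cruxes.PlanarBisectionRigidity.SeamWalkOneSidedBall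

end
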